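import Mathlib
import Summits.ValiantsHypothesis.ValiantsHypothesis.Theorems.DivisionGapTriangularDimersDivisionEasyOddJoinDefs
import Summits.ValiantsHypothesis.ValiantsHypothesis.Theorems.TriangularDimersDivisionEasy.Negative.Basic

/-!
# Crux `DivisionGap.TriangularDimersDivisionEasy` (stmt-ValiantsHypothesis-5067), line `Sketch` —
registered stub `stub_pmSum`

The second half of the FACE IDENTITY for the odd-join polynomial: the perfect-matching sum
`Σ_J Π_{e ∈ J} y_e` over the edge sets `J ⊆ edges n` of the rhombus `R_n` with all degrees
exactly `1` (`y_e = x_e · x_(e.swap)`) IS the crux's dimer polynomial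
`Negative.triPM n = Σ_{f ∈ dimers n} Π_v x_(v, f v)` (the sum over the fixed-point-free
involutions `f` of the vertex set with `v` adjacent to `f v`).

## Proof

* Adjacency versus orientation: `Negative.Adj v w ↔ IsFwd (v, w) ∨ IsFwd (w, v)` (the 1st, 3rd
  and 5th disjuncts of `Adj` are `IsFwd (v, w)`, the other three are `IsFwd (w, v)`); a forward
  pair has distinct endpoints, and its reversal is not forward.
* For a dimer cover `f` let `J_f = {e ∈ edges n | f e.1 = e.2}` (its edges, forward-oriented) and
  let `g_f v` be `(v, f v)` if this pair is forward and `(f v, v)` otherwise.  Then `g_f v` is the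
  UNIQUE member of `J_f` having `v` as an endpoint, so every degree of `J_f` is `1`, and the fibre
  of `g_f` over `e ∈ J_f` is `{e.1, e.2}`; grouping the factors of `Π_v x_(v, f v)` along `g_f`
  (`Finset.prod_fiberwise_of_maps_to`) gives `Π_{e ∈ J_f} x_e · x_(e.swap) = Π_{e ∈ J_f} y_e`
  (on the fibre of `e`: `f e.1 = e.2` and `f e.2 = e.1`).
* `f ↦ J_f` is injective on dimer covers (`f v` is read off from the member of `J_f` at `v`) and
  maps onto the perfect matchings: given `J` with all degrees `1`, let `E v` be the unique member
  of `J` at `v` and `f v` its other endpoint; then `E v = E (f v)` forces `f (f v) = v`, while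
  `f v ≠ v` and `Adj v (f v)` hold because `E v` is a forward pair, and `J_f = J`.
  `Finset.sum_nbij` concludes.  Odd `n` needs no special treatment (both index sets are empty).
-/

-- `Summit.ValiantsHypothesis.ValiantsHypothesis.…` is the tree's mandated single-conjunct layout (Sub = Summit).
set_option linter.dupNamespace false

namespace Summit.ValiantsHypothesis.ValiantsHypothesis.Theorems.TriangularDimersDivisionEasy.OddJoin

open scoped BigOperators NNReal
open Finset MvPolynomial

noncomputable section

namespace PmSum
/-! ### Helper lemmas for `stub_pmSum` (this file's private namespace) -/

variable {n : ℕ}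

/-! #### Orientation versus adjacency -/

/-- The crux's adjacency is the symmetrisation of the forward orientation. [folklore] -/
theorem adj_iff (v w : Vtx n) : Negative.Adj v w ↔ IsFwd (v, w) ∨ IsFwd (w, v) := by
  unfold Negative.Adj IsFwd
  constructor
  · rintro (h | h | h | h | h | h)
    exacts [Or.inl (Or.inl h), Or.inr (Or.inl ⟨h.1, h.2.symm⟩), Or.inl (Or.inr (Or.inl h)),
      Or.inr (Or.inr (Or.inl ⟨h.1.symm, h.2⟩)), Or.inl (Or.inr (Or.inr h)),
      Or.inr (Or.inr (Or.inr h))]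
  · rintro ((h | h | h) | (h | h | h))
    exacts [Or.inl h, Or.inr (Or.inr (Or.inl h)), Or.inr (Or.inr (Or.inr (Or.inr (Or.inl h)))),
      Or.inr (Or.inl ⟨h.1, h.2.symm⟩), Or.inr (Or.inr (Or.inr (Or.inl ⟨h.1.symm, h.2⟩))),
      Or.inr (Or.inr (Or.inr (Or.inr (Or.inr h))))]

/-- A forward pair has two distinct endpoints. [folklore] -/
theorem fst_ne_snd {e : Var n} (h : IsFwd e) : e.1 ≠ e.2 := by
  intro heq
  have h1 : (e.1.1 : ℕ) = e.2.1 := by rw [heq]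
  have h2 : (e.1.2 : ℕ) = e.2.2 := by rw [heq]
  unfold IsFwd at h
  omega

/-- The reversal of a forward pair is not forward. [folklore] -/
theorem not_isFwd_rev {v w : Vtx n} (h : IsFwd (v, w)) : ¬ IsFwd (w, v) := by
  intro h'
  simp only [IsFwd] at h h'
  omega

/-! #### The edge set `J_f = {e ∈ edges n | f e.1 = e.2}` of a dimer cover `f` -/

/-- Membership in `J_f`. [folklore] -/
theorem mem_edgesOf {f : Vtx n → Vtx n} {e : Var n} :
    e ∈ (edges n).filter (fun e => f e.1 = e.2) ↔ IsFwd e ∧ f e.1 = e.2 := by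
  simp only [edges, mem_filter, mem_univ, true_and]

/-- Unbundling membership in `Negative.dimers n`. [folklore] -/
theorem isDimer_of_mem {f : Vtx n → Vtx n} (hf : f ∈ Negative.dimers n) : Negative.IsDimer f := by
  rw [Negative.dimers, mem_filter] at hf
  exact hf.2

/-- The member `g_f v` of `J_f` at `v` (`(v, f v)` or `(f v, v)`, whichever is forward) lies in
`J_f`. [folklore] -/
theorem edgeAt_mem {f : Vtx n → Vtx n} (hf : Negative.IsDimer f) (v : Vtx n) :
    (if IsFwd (v, f v) then (v, f v) else (f v, v)) ∈ (edges n).filter (fun e => f e.1 = e.2) := by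
  rw [mem_edgesOf]
  by_cases h : IsFwd (v, f v)
  · rw [if_pos h]; exact ⟨h, rfl⟩
  · rw [if_neg h]; exact ⟨((adj_iff v (f v)).mp (hf v).2.2).resolve_left h, (hf v).1⟩

/-- `v` is an endpoint of `g_f v`. [folklore] -/
theorem edgeAt_fst_or_snd (f : Vtx n → Vtx n) (v : Vtx n) :
    (if IsFwd (v, f v) then (v, f v) else (f v, v)).1 = v ∨
      (if IsFwd (v, f v) then (v, f v) else (f v, v)).2 = v := by
  by_cases h : IsFwd (v, f v)
  · rw [if_pos h]; exact Or.inl rfl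
  · rw [if_neg h]; exact Or.inr rfl

/-- Uniqueness: a member of `J_f` having `v` as an endpoint is `g_f v`. [folklore] -/
theorem eq_edgeAt {f : Vtx n → Vtx n} (hf : Negative.IsDimer f) {v : Vtx n} {e : Var n}
    (he : e ∈ (edges n).filter (fun e => f e.1 = e.2)) (hv : e.1 = v ∨ e.2 = v) :
    e = if IsFwd (v, f v) then (v, f v) else (f v, v) := by
  rw [mem_edgesOf] at he
  obtain ⟨hfwd, hfe⟩ := he
  rcases hv with rfl | rfl
  · rw [hfe, Prod.mk.eta, if_pos hfwd]
  · have h2 : f e.2 = e.1 := by rw [← hfe]; exact (hf e.1).1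
    have hns : ¬ IsFwd (e.2, e.1) := not_isFwd_rev (v := e.1) (w := e.2) hfwd
    rw [h2, if_neg hns, Prod.mk.eta]

/-- The members of `J_f` at `v`: exactly `g_f v`. [folklore] -/
theorem filter_edgesOf_eq {f : Vtx n → Vtx n} (hf : Negative.IsDimer f) (v : Vtx n) :
    ((edges n).filter (fun e => f e.1 = e.2)).filter (fun e => e.1 = v ∨ e.2 = v) =
      {if IsFwd (v, f v) then (v, f v) else (f v, v)} := by
  ext e
  rw [mem_filter, mem_singleton]
  constructor
  · rintro ⟨he, hv⟩
    exact eq_edgeAt hf he hv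
  · rintro rfl
    exact ⟨edgeAt_mem hf v, edgeAt_fst_or_snd f v⟩

/-- Every vertex has degree `1` in `J_f`. [folklore] -/
theorem deg_edgesOf {f : Vtx n → Vtx n} (hf : Negative.IsDimer f) (v : Vtx n) :
    deg ((edges n).filter (fun e => f e.1 = e.2)) v = 1 := by
  unfold deg
  rw [filter_edgesOf_eq hf v, card_singleton]

/-- `J_f` is a perfect matching of `R_n`. [folklore] -/
theorem edgesOf_mem {f : Vtx n → Vtx n} (hf : f ∈ Negative.dimers n) :
    (edges n).filter (fun e => f e.1 = e.2) ∈
      (edges n).powerset.filter (fun J => ∀ v : Vtx n, deg J v = 1) := by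
  rw [mem_filter, mem_powerset]
  exact ⟨filter_subset _ _, fun v => deg_edgesOf (isDimer_of_mem hf) v⟩

/-! #### The dimer monomial of `f` as a product over `J_f` -/

/-- The fibre of `g_f` over `e ∈ J_f` is `{e.1, e.2}`. [folklore] -/
theorem fiber_edgeAt {f : Vtx n → Vtx n} (hf : Negative.IsDimer f) {e : Var n}
    (he : e ∈ (edges n).filter (fun e => f e.1 = e.2)) :
    univ.filter (fun v => (if IsFwd (v, f v) then (v, f v) else (f v, v)) = e) = {e.1, e.2} := by
  ext v
  simp only [mem_filter, mem_univ, true_and, mem_insert, mem_singleton]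
  constructor
  · intro hv
    rcases edgeAt_fst_or_snd f v with h | h
    · rw [hv] at h; exact Or.inl h.symm
    · rw [hv] at h; exact Or.inr h.symm
  · rintro (rfl | rfl)
    · exact (eq_edgeAt hf he (Or.inl rfl)).symm
    · exact (eq_edgeAt hf he (Or.inr rfl)).symm

/-- The dimer monomial of `f` is `Π_{e ∈ J_f} y_e`. [folklore] -/
theorem prod_X_eq {f : Vtx n → Vtx n} (hf : Negative.IsDimer f) :
    ∏ v : Vtx n, (X (v, f v) : MvPolynomial (Var n) ℝ≥0) =
      ∏ e ∈ (edges n).filter (fun e => f e.1 = e.2), yv e := by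
  rw [← prod_fiberwise_of_maps_to (s := univ) (t := (edges n).filter (fun e => f e.1 = e.2))
    (g := fun v => if IsFwd (v, f v) then (v, f v) else (f v, v)) (fun v _ => edgeAt_mem hf v)]
  refine prod_congr rfl fun e he => ?_
  obtain ⟨hfwd, hfe⟩ := mem_edgesOf.mp he
  have h2 : f e.2 = e.1 := by rw [← hfe]; exact (hf e.1).1
  rw [fiber_edgeAt hf he, prod_pair (fst_ne_snd hfwd), hfe, h2, yv]
  rfl

/-! #### `f ↦ J_f` is a bijection from the dimer covers onto the perfect matchings -/

/-- `f ↦ J_f` is injective on dimer covers. [folklore] -/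
theorem edgesOf_injOn :
    Set.InjOn (fun f : Vtx n → Vtx n => (edges n).filter (fun e => f e.1 = e.2))
      ↑(Negative.dimers n) := by
  intro f hf g hg hfg
  have hf' := isDimer_of_mem (mem_coe.mp hf)
  have hg' := isDimer_of_mem (mem_coe.mp hg)
  have hfg' : (edges n).filter (fun e => f e.1 = e.2) = (edges n).filter (fun e => g e.1 = e.2) :=
    hfg
  have key : ∀ e : Var n, IsFwd e ∧ f e.1 = e.2 → IsFwd e ∧ g e.1 = e.2 := fun e he => by
    have h : e ∈ (edges n).filter (fun e => f e.1 = e.2) := mem_edgesOf.mpr he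
    rw [hfg'] at h
    exact mem_edgesOf.mp h
  funext v
  rcases (adj_iff v (f v)).mp (hf' v).2.2 with h | h
  · exact ((key (v, f v) ⟨h, rfl⟩).2).symm
  · have hgv : g (f v) = v := (key (f v, v) ⟨h, (hf' v).1⟩).2
    calc f v = g (g (f v)) := ((hg' (f v)).1).symm
      _ = g v := by rw [hgv]

/-- `f ↦ J_f` maps the dimer covers onto the perfect matchings. [folklore] -/
theorem edgesOf_surjOn :
    Set.SurjOn (fun f : Vtx n → Vtx n => (edges n).filter (fun e => f e.1 = e.2))
      ↑(Negative.dimers n) ↑((edges n).powerset.filter (fun J => ∀ v : Vtx n, deg J v = 1)) := by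
  intro J hJ
  rw [mem_coe, mem_filter, mem_powerset] at hJ
  obtain ⟨hsub, hdeg⟩ := hJ
  have hfwd : ∀ e ∈ J, IsFwd e := fun e he => by
    have h := hsub he
    unfold edges at h
    exact (mem_filter.mp h).2
  -- `E v`: the unique member of `J` at `v`
  have hex : ∀ v : Vtx n, ∃ e : Var n, J.filter (fun e => e.1 = v ∨ e.2 = v) = {e} := fun v =>
    card_eq_one.mp (hdeg v)
  choose E hE using hex
  have hE1 : ∀ v, E v ∈ J ∧ ((E v).1 = v ∨ (E v).2 = v) := fun v => by
    have h := mem_singleton_self (E v)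
    rw [← hE v, mem_filter] at h
    exact h
  have hE2 : ∀ v, ∀ e ∈ J, (e.1 = v ∨ e.2 = v) → e = E v := fun v e he hv => by
    have h : e ∈ J.filter (fun e => e.1 = v ∨ e.2 = v) := mem_filter.mpr ⟨he, hv⟩
    rwa [hE v, mem_singleton] at h
  -- `f v`: the other endpoint of `E v`
  obtain ⟨f, hf⟩ :
      ∃ f : Vtx n → Vtx n, f = fun v => if (E v).1 = v then (E v).2 else (E v).1 := ⟨_, rfl⟩
  have hEf : ∀ v, E v = (v, f v) ∨ E v = (f v, v) := fun v => by
    by_cases h : (E v).1 = v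
    · left
      have hfv : f v = (E v).2 := by simp only [hf, if_pos h]
      rw [hfv]
      exact Prod.ext h rfl
    · right
      have hfv : f v = (E v).1 := by simp only [hf, if_neg h]
      rw [hfv]
      exact Prod.ext rfl ((hE1 v).2.resolve_left h)
  have hne : ∀ v, f v ≠ v := fun v hfv => by
    apply fst_ne_snd (hfwd _ (hE1 v).1)
    rcases hEf v with h | h
    · rw [h]; exact hfv.symm
    · rw [h]; exact hfv
  have hinv : ∀ v, f (f v) = v := fun v => by
    have hvw : (E v).1 = f v ∨ (E v).2 = f v := by
      rcases hEf v with h | h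
      · rw [h]; exact Or.inr rfl
      · rw [h]; exact Or.inl rfl
    have hEvw : E v = E (f v) := hE2 (f v) (E v) (hE1 v).1 hvw
    rcases hEf v with h | h
    · rw [hEvw] at h
      rcases hEf (f v) with h' | h'
      · rw [h, Prod.mk.injEq] at h'
        exact absurd h'.1.symm (hne v)
      · rw [h, Prod.mk.injEq] at h'
        exact h'.1.symm
    · rw [hEvw] at h
      rcases hEf (f v) with h' | h'
      · rw [h, Prod.mk.injEq] at h'
        exact h'.2.symm
      · rw [h, Prod.mk.injEq] at h'
        exact absurd h'.2.symm (hne v)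
  refine ⟨f, ?_, ?_⟩
  · -- `f` is a dimer cover
    rw [mem_coe, Negative.dimers, mem_filter]
    refine ⟨mem_univ _, fun v => ⟨hinv v, hne v, ?_⟩⟩
    rw [adj_iff]
    rcases hEf v with h | h
    · left; rw [← h]; exact hfwd _ (hE1 v).1
    · right; rw [← h]; exact hfwd _ (hE1 v).1
  · -- `J_f = J`
    show (edges n).filter (fun e => f e.1 = e.2) = J
    ext e
    rw [mem_edgesOf]
    constructor
    · rintro ⟨hefwd, hfe⟩
      rcases hEf e.1 with h | h
      · rw [hfe, Prod.mk.eta] at h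
        have h' := (hE1 e.1).1
        rwa [h] at h'
      · exfalso
        rw [hfe] at h
        have h' := hfwd _ (hE1 e.1).1
        rw [h] at h'
        exact not_isFwd_rev (v := e.1) (w := e.2) hefwd h'
    · intro he
      refine ⟨hfwd e he, ?_⟩
      have hEe : e = E e.1 := hE2 e.1 e he (Or.inl rfl)
      rcases hEf e.1 with h | h
      · rw [← hEe] at h
        have h2 : e.2 = f e.1 := congrArg Prod.snd h
        exact h2.symm
      · rw [← hEe] at h
        have h1 : e.1 = f e.1 := congrArg Prod.fst h
        have h2 : e.2 = e.1 := congrArg Prod.snd h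
        rw [h2]; exact h1.symm

end PmSum

open PmSum in
/-- Registered stub `stub_pmSum`: the perfect-matching sum `Σ_J Π_{e ∈ J} y_e` over the edge sets
of `R_n` with all degrees `1` is the crux's dimer polynomial `D_n = Negative.triPM n`. [folklore] -/
theorem stub_pmSum (n : ℕ) :
    (∑ J ∈ (edges n).powerset.filter (fun J => ∀ v : Vtx n, deg J v = 1), ∏ e ∈ J, yv e) =
      Negative.triPM n := by
  rw [Negative.triPM]
  symm
  exact sum_nbij (fun f => (edges n).filter (fun e => f e.1 = e.2)) (fun f hf => edgesOf_mem hf)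
    edgesOf_injOn edgesOf_surjOn (fun f hf => prod_X_eq (isDimer_of_mem hf))

end

end Summit.ValiantsHypothesis.ValiantsHypothesis.Theorems.TriangularDimersDivisionEasy.OddJoin
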